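import Mathlib.MeasureTheory.Integral.IntervalIntegral.Basic
import Mathlib.Analysis.SpecialFunctions.Log.Basic
import Literature.Analysis.FunctionSpaces.FlatTorus
import Literature.Analysis.FunctionSpaces.TorusCalculus
import Literature.Analysis.FunctionSpaces.TorusFluidGlue
import Literature.Analysis.FluidPDE.NSWave0
import Literature.Analysis.FluidPDE.TaoLocalisation
import Literature.Claims.NS.ClayVariants
import HarnessLib

/-!
# Claim skeleton (D-0090 NS-CLAIMS, C85): Stanley, OSF Preprints 8hv92 v1 (2025) — «every divergence–free L² initial datum produces a unique, global, smooth solution … on ℝ³»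

Typed skeleton (ns-claims-typist-7 g2; row C85 PROMOTED T2, lead v1.27 / v1.29b–d) of Dustyn
Stanley, *All Proofs Relating to The Complete Proof of Navier-Stokes Existence and Smoothness*, OSF
Preprints **8hv92 version 1** (posted 2025-05-16), doi:10.31219/osf.io/8hv92_v1, 59 pp. (bib
`Stanley2025`; PDF page = printed page; per-page text `pub/ns-claims/sources/Stanley2025/text/pNNN.txt`,
renders p001/p024/p026/p027/p028, LOCATORS.md by ns-claims-lit-1 g4). Only version (no withdrawal, no
journal). UNREFEREED CLAIM under adjudication — NOTHING in this file asserts a step of the paper: its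
statements are `def … : Prop`; the `theorem`s are kernel-checked relations between them. Card
`pub/ns-claims/claims/Stanley2025/CARD.md` (PREDICTION §4 frozen 2026-08-27T01:12Z, sha16
9008356fe38d0f58).

## The claimed statement

Executive Summary p.1: «Clay–Millennium statement. We prove that every divergence–free L² initial
datum produces a unique, global, smooth solution of the three-dimensional incompressible Navier–Stokes
equations on ℝ³. The final construction appears in Appendix item 32 ("Passage to the limit α → 0
recovering u"), with backward-uniqueness closed in item 37.» OSF abstract: «We show that any smooth,
divergence-free velocity field with finite energy evolves into a unique, globally smooth solution of the
three-dimensional incompressible Navier–Stokes equations in ordinary space … completing the Clay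
criteria for existence, regularity, uniqueness, and energy conservation.» Typed: `ClaimedTheorem` =
the abstract's sentence over the tree's vocabulary on `ℝ³` (smooth divergence-free datum of FINITE
ENERGY — wider than Clay's class (4); conclusion: smooth `(u, p)` on `ℝ³ × [0,∞)` solving (1)–(3) with
bounded energy (7); uniqueness and «energy conservation» are not typed — QUICK grain, flagged). The
p.1 variant «every divergence–free L² datum» (no smoothness) is recorded, not typed. Clay link:
`clay_of_claimed : ClaimedTheorem → ClayVariants.clayR3.Regularity` is PROVED (Clay data have finite
energy: `HasRapidSpatialDecay.lintegral_enorm_iteratedFDeriv_sq_lt_top`) — the row is (A)-shaped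
and STRONGER in data: not a «wrong problem» candidate; the adjudication is about the steps.

## Clay delta (CARD §3; reference `Literature.Claims.NS.ClayVariants`)

Δ1 = (ℝ³; estimates proved on 𝕋³ and transferred by items 38–43 — an internal step, `Step_transfer`)
· Δ2 = · Δ3 = (f ≡ 0) · Δ4 ⊇ (finite-energy smooth data ⊇ (4)) · Δ5 = C^∞ + (7) · Δ6 = · Δ7 =
(ν > 0 fixed arbitrary).

## Architecture (pp.23–28 the «entropy device»; p.21 BKM; pp.35–42 suppression/limit; pp.52–54 transfer) and the typed steps

ORDER OF RECORD (dependency order; print pages):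
* Step 1 = `Step_L14` — **Lemma 14 p.26** («Exact Cancellation of Convective and Pressure
  Contributions»): for a smooth divergence-free solution on 𝕋³, `I_conv + I_press = 0` with
  `I_conv = −∫2F′_η(|u|²)uᵢuⱼ∂ⱼuᵢ`, `I_press = −∫2F′_η(|u|²)uᵢ∂ᵢp`, `F′_η(s) = ln(1 + s/η)` (Lemma 11
  p.23). Consumed by Lemma 12's proof (p.24: the convective and pressure pairings of `⟨S′_η(u), ∂ₜu⟩`
  are dropped) and by Prop 2 Step 1 (p.27 «use Lemma 14 to kill the convective and pressure terms»).
  (Its printed proof ends with «2∫p F″_η(|u|²)uᵢuⱼ∂ᵢuⱼ dx = 2∫p F′_η(|u|²)uᵢuⱼ∂ⱼuᵢ dx = −I_conv» —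
  an equation between an integral containing `p` and one that does not; erratum-grade, not typed.)
  FIELD-LEVEL COMPANION (rev 2, HYGIENE 13, referee's request): `Step_L14Abs` — the same identity for
  every smooth divergence-free field `u` and every smooth `p` with `Δp = −div((u·∇)u)` (the slice
  pressure equation), no solution needed.
* Step 2 = `Step_L12` — **Lemma 12 p.24** («Dissipation of S_η»): `d/dt S_η(u(t)) ≤ 0` for smooth
  solutions on 𝕋³ (typed: `t ↦ S_η(u(t))` is antitone on the time set).
* Step 3 = `Step_P2S1` — **Proposition 2 (item 17) p.27, proof Step 1** «Enstrophy balance. Take the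
  L²-inner product of the Navier–Stokes equation with −Δu, integrate over 𝕋³, and use Lemma 14 to kill
  the convective and pressure terms: ½ d/dt X(t) + ν‖Δu‖²_{L²} = 0» (X = ‖∇u‖²_{L²}), «Hence X(t) ≤ X(0),
  ∫₀ᵀ‖Δu‖² ≤ X(0)/(2ν)» (p.28) — typed in integrated form; FIELD-LEVEL COMPANION `Step_P2S1Abs`
  (HYGIENE 13): the killed convective pairing `∫_{𝕋³}⟨(u·∇)u, Δu⟩ = 0` for every smooth
  divergence-free periodic field (the slice-level content of «kill the convective term»; the pressure
  pairing `∫⟨∇p, Δu⟩` does vanish for divergence-free `u`).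
* Step 4 = `Step_P2` — **Proposition 2 p.27–28**: `∫₀ᵀ‖∇u(t)‖²_{L∞} dt ≤ C(ν,η)(T + ‖∇u₀‖²_{L²} + S_η(u₀))`
  for smooth divergence-free solutions on 𝕋³, «C = C(ν,η)» uniform — typed as the implication the
  printed proof asserts: Steps 1–3 (+ Lemma 15 log-Sobolev, Kozono–Taniuchi, classical, not typed) ⇒
  `PropTwoBound`.
* Step 5 = `Step_T3reg` — **Theorem 5 (BKM) p.21 + items 24–32 pp.35–42 (Theorem 6 global suppressed
  solutions, Proposition 6 uniform estimates, Theorem 7 p.41 «u_α → u … where u is the unique Leray–Hopf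
  weak solution … and in particular is smooth for all t > 0»)**: the Lipschitz-integrability bound
  yields global smooth solutions on 𝕋³ for all smooth divergence-free data — `PropTwoBound →
  T3GlobalRegularity`.
* Step 6 = `Step_transfer` — **items 38–43 pp.52–54** («Scale-free transfer from periodic box to whole
  space»; p.54 «Since all estimates are uniform in L … one takes L → ∞ to recover the corresponding
  estimate for u on ℝ³»): `T3GlobalRegularity → ClaimedTheorem` (the unit torus stands for every
  `𝕋³_L` by the Navier–Stokes scaling, cf. `ClayPeriodScalingBridge`).
* Recorded display, not on the composition path: `Step_L11growth` — **Lemma 11(4) p.23–24** «Uniform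
  quadratic growth: F_η(s) ≤ C s²/(s+η) for all s ≥ 0» (used only where S_η is to be controlled by the
  energy, i.e. for the p.1 «every L² datum» sentence; for smooth periodic data S_η(u₀) is finite
  outright).

COMPOSITION — PROVED, every step consumed: `claim_of_steps : Step_L14 → Step_L12 → Step_P2S1 →
Step_P2 → Step_T3reg → Step_transfer → ClaimedTheorem` (Step 4's antecedent is Steps 1–3);
`clay_of_claimed : ClaimedTheorem → ClayVariants.clayR3.Regularity` PROVED.

Kernel handles recorded for the refuter/referee (no verdict here): `Step_P2S1Abs` quantifies over all
smooth divergence-free fields on the unit 3-torus (a Beltrami/ABC field is NOT a witness — its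
convective term is a gradient; single-mode-per-component fields cancel too; a genuinely interacting
two-mode field is needed); `Step_P2S1`/`Step_L12`/`Step_L14` quantify over classical solutions on 𝕋³
(tree: `Torus.IsClassicalNSSolutionOn`, Taylor–Green / `orrFlow`-type enstrophy growth,
`Literature.Barriers.NavierStokesRegularity.VortexStretchingAprioriBounds`); `Step_L11growth` is
elementary real analysis (`F_η(s) ~ s ln s`).

WHAT THIS IS NOT: not a claim about NS regularity or blow-up; not a claim about any author beyond the
typed locator.
-/

open scoped ContDiff ENNReal InnerProductSpace RealInnerProductSpace
open _root_.MeasureTheory _root_.Set Function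

namespace Literature.Claims.NS.Stanley2025

open Literature.Analysis.FunctionSpaces Literature.Analysis.FluidPDE

noncomputable section

/-! ## A. Vocabulary (definitions with bodies; nothing asserted) -/

/-- The unit 3-torus `𝕋³` (the paper's periodic box; any period by NS scaling).
[cite: Stanley2025, §14 Definition 2 p.23] -/
abbrev T3 : Type := UnitAddTorus (Fin 3)

/-- Physical space `ℝ³` (values of the velocity; the whole-space statement p.1).
[cite: Stanley2025, Executive Summary p.1] -/
abbrev E3 : Type := EuclideanSpace ℝ (Fin 3)

/-- **Definition 2 p.23**: `F_η(s) = (s + η) ln(1 + s/η) − s`, `s ≥ 0`, `η > 0`.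
[cite: Stanley2025, Definition 2 p.23] -/
def Feta (η s : ℝ) : ℝ :=
  (s + η) * Real.log (1 + s / η) - s

/-- **Lemma 11(2) p.23**: `F′_η(s) = ln(1 + s/η)` (the weight appearing in `I_conv`, `I_press`).
[cite: Stanley2025, Lemma 11(2) p.23] -/
def dFeta (η s : ℝ) : ℝ :=
  Real.log (1 + s / η)

/-- **Definition 2 p.23**: the log-entropy `S_η(u) = ∫_{𝕋³} F_η(|u(x)|²) dx`.
[cite: Stanley2025, Definition 2 p.23] -/
def entropyS (η : ℝ) (u : T3 → E3) : ℝ :=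
  ∫ x, Feta η (‖u x‖ ^ 2)

/-- **Lemma 14 p.26**: `I_conv = −∫_{𝕋³} 2F′_η(|u|²) uᵢuⱼ∂ⱼuᵢ dx` (`uᵢuⱼ∂ⱼuᵢ = u·((u·∇)u)`).
[cite: Stanley2025, Lemma 14 p.26] -/
def Iconv (η : ℝ) (u : T3 → E3) : ℝ :=
  -∫ x, 2 * dFeta η (‖u x‖ ^ 2) * ⟪u x, Torus.convect u u x⟫

/-- **Lemma 14 p.26**: `I_press = −∫_{𝕋³} 2F′_η(|u|²) uᵢ∂ᵢp dx`. [cite: Stanley2025, Lemma 14 p.26] -/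
def Ipress (η : ℝ) (u : T3 → E3) (p : T3 → ℝ) : ℝ :=
  -∫ x, 2 * dFeta η (‖u x‖ ^ 2) * ⟪u x, Torus.gradient p x⟫

/-- **Prop 2 p.27**: `X = ‖∇u‖²_{L²(𝕋³)}` (the tree's `Torus.gradNormSq`). [cite: Stanley2025, Proposition 2 p.27] -/
def Xgrad (u : T3 → E3) : ℝ :=
  Torus.gradNormSq u

/-- **Prop 2 p.27**: `‖Δu‖²_{L²(𝕋³)}`. [cite: Stanley2025, Proposition 2 p.27] -/
def lapNormSq (u : T3 → E3) : ℝ :=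
  ∫ x, ‖Torus.laplacian u x‖ ^ 2

/-- **Prop 2 p.27**: `‖∇u‖²_{L∞(𝕋³)}` in `[0,∞]` (supremum of the operator norm of the spatial
derivative; no junk value). [cite: Stanley2025, Proposition 2 p.27] -/
def eLipSq (u : T3 → E3) : ℝ≥0∞ :=
  (⨆ x, ‖Torus.fderiv u x‖ₑ) ^ 2

/-! ## B. The claimed statement and the intermediate statements -/

/-- **The claimed statement** (OSF abstract; Executive Summary p.1; Theorem 7 p.41 «smooth for all
t > 0»): for every viscosity `ν > 0` and every smooth divergence-free datum of finite energy on `ℝ³`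
there is a smooth solution `(u, p)` of the unforced Navier–Stokes system on `ℝ³ × [0,∞)` with
`u(0) = u₀` and bounded energy. (Uniqueness, «energy conservation» and the p.1 variant «every
divergence-free L² datum» are not typed.) [claim: Stanley2025, status: disputed] -/
def ClaimedTheorem : Prop :=
  ∀ ν : ℝ, 0 < ν → ∀ u₀ : E3 → E3, ContDiff ℝ ∞ u₀ → NSWave0.IsDivFree u₀ →
    (∫⁻ x, ‖u₀ x‖ₑ ^ 2) < (⊤ : ℝ≥0∞) →
      ∃ (u : ℝ → E3 → E3) (p : ℝ → E3 → ℝ),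
        IsSmoothOnHalfSpace u ∧ IsSmoothOnHalfSpace p ∧ IsNavierStokesSolution ν 0 u₀ u p ∧
          HasBoundedEnergy u

/-- **Proposition 2 p.27 as a standalone statement** («Integrability of the Lipschitz norm»): there is
`C = C(ν, η) > 0` such that every smooth divergence-free solution on `𝕋³ × [0,T]` obeys
`∫₀ᵀ ‖∇u(t)‖²_{L∞} dt ≤ C (T + ‖∇u₀‖²_{L²} + S_η(u₀))` (left side as a lower Lebesgue integral in
`[0,∞]`). [claim: Stanley2025, status: disputed] -/
def PropTwoBound : Prop :=
  ∀ ν η : ℝ, 0 < ν → 0 < η → ∃ C : ℝ, 0 < C ∧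
    ∀ (T : ℝ) (u : ℝ → T3 → E3) (p : ℝ → T3 → ℝ), 0 < T →
      Torus.IsClassicalNSSolutionOn (Icc 0 T) ν 0 u p →
        ∫⁻ t in Ioo 0 T, eLipSq (u t) ≤
          ENNReal.ofReal (C * (T + Xgrad (u 0) + entropyS η (u 0)))

/-- **Global regularity on the torus** (the conclusion of items 24–32, Theorem 7 p.41: «u … is smooth
for all t > 0», for all `H²_σ` data; typed for smooth divergence-free data): every smooth
divergence-free datum on `𝕋³` has a global classical solution. [claim: Stanley2025, status: disputed] -/
def T3GlobalRegularity : Prop :=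
  ∀ ν : ℝ, 0 < ν → ∀ u₀ : T3 → E3, Torus.IsSmooth u₀ → Torus.IsDivFree u₀ →
    ∃ (u : ℝ → T3 → E3) (p : ℝ → T3 → ℝ), Torus.IsClassicalNSSolutionOn (Ici 0) ν 0 u p ∧ u 0 = u₀

/-! ## C. The steps -/

/-- **Step 1 — Lemma 14 p.26**: «Let u(t,x) be a smooth divergence-free solution of Navier–Stokes on
𝕋³. Then I_conv + I_press = 0.» Typed for every classical unforced solution on a time set `S`, at every
`t ∈ S`, every `η > 0`. [claim: Stanley2025, status: disputed] -/
def Step_L14 : Prop :=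
  ∀ (η ν : ℝ) (S : Set ℝ) (u : ℝ → T3 → E3) (p : ℝ → T3 → ℝ), 0 < η → 0 < ν →
    Torus.IsClassicalNSSolutionOn S ν 0 u p → ∀ t ∈ S, Iconv η (u t) + Ipress η (u t) (p t) = 0

/-- **Step 1, field-level companion (HYGIENE 13; rev 2, referee ns-claims-ref-1 g2's request
2026-08-27T01:42Z)** — Lemma 14 p.26 at a single time, with no solution in the hypotheses: for every
`η > 0`, every smooth divergence-free field `u` on `𝕋³` and every smooth `p` solving the pressure
Poisson equation `Δp = −div((u·∇)u)` (the equation the pressure of a classical solution satisfies on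
each slice), `I_conv + I_press = 0`. The printed proof of Lemma 14 uses nothing about time evolution, so
this is the content it actually asserts; kernel-testable by a finite Fourier computation.
[claim: Stanley2025, status: disputed] -/
def Step_L14Abs : Prop :=
  ∀ (η : ℝ) (u : T3 → E3) (p : T3 → ℝ), 0 < η → Torus.IsSmooth u → Torus.IsDivFree u →
    Torus.IsSmooth p → (∀ x, Torus.laplacian p x = -Torus.divergence (Torus.convect u u) x) →
      Iconv η u + Ipress η u p = 0

/-- **Step 2 — Lemma 12 p.24**: «Let u(t) be a smooth solution of Navier–Stokes on 𝕋³. Then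
d/dt S_η(u(t)) ≤ 0.» Typed: the log-entropy is non-increasing in time along every classical unforced
solution on a convex time set. [claim: Stanley2025, status: disputed] -/
def Step_L12 : Prop :=
  ∀ (η ν : ℝ) (S : Set ℝ) (u : ℝ → T3 → E3) (p : ℝ → T3 → ℝ), 0 < η → 0 < ν → Convex ℝ S →
    Torus.IsClassicalNSSolutionOn S ν 0 u p → AntitoneOn (fun t => entropyS η (u t)) S

/-- **Step 3 — Proposition 2, proof Step 1 p.27–28**: «Enstrophy balance … ½ d/dt X(t) + ν‖Δu‖²_{L²}
= 0. Hence X(t) ≤ X(0), ∫₀ᵀ‖Δu‖²dt = (X(0) − X(T))/(2ν)», typed in integrated form for classical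
unforced solutions on `𝕋³ × [0,T]`: `X(t) + 2ν∫₀ᵗ‖Δu‖² = X(0)` for every `t ∈ [0,T]`.
[claim: Stanley2025, status: disputed] -/
def Step_P2S1 : Prop :=
  ∀ (ν T : ℝ) (u : ℝ → T3 → E3) (p : ℝ → T3 → ℝ), 0 < ν → 0 < T →
    Torus.IsClassicalNSSolutionOn (Icc 0 T) ν 0 u p →
      ∀ t ∈ Icc 0 T, Xgrad (u t) + 2 * ν * ∫ s in (0 : ℝ)..t, lapNormSq (u s) = Xgrad (u 0)

/-- **Step 3, field-level companion (HYGIENE 13)** — the content of «use Lemma 14 to kill the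
convective … terms» at a single time: for every smooth divergence-free field on `𝕋³` the convective
pairing with the Laplacian vanishes, `∫_{𝕋³} ⟨(u·∇)u, Δu⟩ dx = 0` (the pressure pairing `∫⟨∇p, Δu⟩`
vanishes genuinely for divergence-free `u` and is not typed). [claim: Stanley2025, status: disputed] -/
def Step_P2S1Abs : Prop :=
  ∀ u : T3 → E3, Torus.IsSmooth u → Torus.IsDivFree u →
    ∫ x, ⟪Torus.convect u u x, Torus.laplacian u x⟫ = 0

/-- **Step 4 — Proposition 2 p.27–28**, as the implication its printed proof asserts: Lemma 14, Lemma 12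
(«By Lemma 12 … S_η(u(t)) ≤ E₀», Step 3) and the enstrophy balance (Step 1), together with the
log-Sobolev inequality (Lemma 13/15 pp.25–27, Kozono–Taniuchi — classical, not typed), give the
Lipschitz-integrability bound. [claim: Stanley2025, status: disputed] -/
def Step_P2 : Prop :=
  Step_L14 ∧ Step_L12 ∧ Step_P2S1 → PropTwoBound

/-- **Step 5 — Theorem 5 (BKM) p.21 with items 24–32 pp.35–42** (Theorem 6 p.40 global suppressed
solutions, Proposition 6 uniform estimates «uniform-in-α», Theorem 7 p.41 «as α → 0, u_α → u … the
unique Leray–Hopf weak solution … satisfies all the same uniform estimates of Proposition 6, and in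
particular is smooth for all t > 0»): the bound of Proposition 2 yields global smooth solutions on 𝕋³.
[claim: Stanley2025, status: disputed] -/
def Step_T3reg : Prop :=
  PropTwoBound → T3GlobalRegularity

/-- **Step 6 — items 38–43 pp.52–54** («Scale-free transfer from periodic box to whole space»: cube
partition, Bogovskiĭ correction, «all estimates are uniform in L … one takes L → ∞ to recover the
corresponding estimate for u on ℝ³», p.54): global regularity on the torus yields the whole-space
statement. [claim: Stanley2025, status: disputed] -/
def Step_transfer : Prop :=
  T3GlobalRegularity → ClaimedTheorem

/-- **Recorded display — Lemma 11(4) p.23–24** «Uniform quadratic growth: … Then for all s ≥ 0,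
F_η(s) ≤ C s²/(s + η)» (printed with the explicit `C = max{C₁, 1/(2η)}`; typed charitably with some
constant). Not on the composition path (see module docstring). [claim: Stanley2025, status: disputed] -/
def Step_L11growth : Prop :=
  ∀ η : ℝ, 0 < η → ∃ C : ℝ, ∀ s : ℝ, 0 ≤ s → Feta η s ≤ C * (s ^ 2 / (s + η))

/-! ## D. Kernel-checked relations (pure logic; nothing of the paper is asserted) -/

/-- **COMPOSITION** — PROVED; every step consumed (Steps 1–3 through Step 4's antecedent).
[cite: Stanley2025, pp.23–28, p.41, pp.52–54] -/
theorem claim_of_steps (h1 : Step_L14) (h2 : Step_L12) (h3 : Step_P2S1) (h4 : Step_P2)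
    (h5 : Step_T3reg) (h6 : Step_transfer) : ClaimedTheorem :=
  h6 (h5 (h4 ⟨h1, h2, h3⟩))

/-- **Clay link**: the typed claim implies Clay (A) — Clay data (4) have finite energy
(`HasRapidSpatialDecay.lintegral_enorm_iteratedFDeriv_sq_lt_top` with `n = 0`), and the claim's
conclusion is exactly (A)'s. [cite: FeffermanClay2006, (A) p. 2] -/
theorem clay_of_claimed (h : ClaimedTheorem) : ClayVariants.clayR3.Regularity := by
  intro ν hν u₀ hu₀ hdiv hdec
  have h0 := hdec.lintegral_enorm_iteratedFDeriv_sq_lt_top (μ := (volume : Measure E3)) 0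
  have hE : (∫⁻ x, ‖u₀ x‖ₑ ^ 2) < (⊤ : ℝ≥0∞) := by
    have : (fun x => ‖iteratedFDeriv ℝ 0 u₀ x‖ₑ ^ 2) = fun x => ‖u₀ x‖ₑ ^ 2 := by
      funext x
      rw [← ofReal_norm, ← ofReal_norm, norm_iteratedFDeriv_zero]
    rw [this] at h0
    exact h0
  obtain ⟨u, p, hu, hp, hns, hEn⟩ := h ν hν u₀ hu₀ hdiv hE
  exact ⟨u, p, hu, hp, hns, hEn⟩

end

end Literature.Claims.NS.Stanley2025
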